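import Summits.QuantumFields.YangMills.Theorems.BalabanUVNodesN15CurvedGluingCubeDressedGeneral
import HarnessLib

/-!
# Route «BalabanUVNodes» (cluster K4 «SpineRates»), Track-A DAG node N15 = NE2, BACKGROUND LAYER — THE η-DEFECT OF THE DRESSED CUBE PAIR WITH A DECAYING PERTURBATION OF THE JET
# (Thm 3.14's template for the (3.76) edition), and its two-sided localization

Cell `pub-ymgap`, seat `pub-ymgap-dag-n15-w3` (WIDTH SEAT 3∕3 on node N15, director-ym №197 ∕ HUMAN RULING D-0149; plan `W-SEAT-START-LIST.md` §n15 item 3 — twenty-fourth piece: the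
two-grid half of file 23).  `bears_on: R4∕N15 · K3⁷ SpineGivenEndpointR13SepCoPH (stmt-QuantumFields-20544)`.  Filed `--kind proof --supports stmt-QuantumFields-20544 --as helper` —
COUNT-NEUTRAL.  Theorems only; 0 `sorry`.  Imports BY NAME file 23 `…N15CurvedGluingCubeDressedGeneral` (`hasMaj_stepVE`, `isUnit_stepVE`, `hasMaj_bgPropVE`, `projO_none_dressedV`,
`dressedV_comp_eq_self`; file 21 `mulOp_eq_zero_of_vanish`; dag-n15-c B1a `bgPropV_fix`, B2 `idef_stack`∕`hasMaj_stack`∕`hasMaj_projO_comp`∕`liftPair`, A2 `idef_background_propagator_majorant_flat`,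
FILE 47 `hasMaj_localize`; lit `hasMaj_comp_exp`, `wrow_of_exp`, `T4EtaRateDefect.idef`); nothing in the tree is modified.

WHY.  FILE 55's bundle also wants the two-grid defects of the cube rows (`hIG`, `hIDG`, …: `𝔇(G′_□, G_□) ≤ 1_S1_S·m₀e^{−δd}`).  For the cube dressed by an ARBITRARY decaying perturbation
`V̂` of the jet (file 23: species + averaging words + the nonlocal `P₁(A)`), the defect obeys the fixed-point equation of dag-n15-c's A2 background step — `𝔇(X̂′, X̂) = 𝔇(Ŝ′, Ŝ) +
𝔇(Ŝ′V̂′, ŜV̂)X̂ + (Ŝ′V̂′)𝔇(X̂′, X̂)` — whose engine `idef_background_propagator_majorant_flat` is generic in the perturbation; B1a's `hasMaj_idef_bgPropV` fed it `diagK` letters, THIS FILE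
feeds it DECAYING letters `V̂ ≤ Re^{−δ_Vd}`, `𝔇(V̂′, V̂) ≤ oe^{−δ_Vd}` (two uses of lit `hasMaj_comp_exp` for the sandwiched perturbation defect).  Then the jet pair: the stacked flat
defect is the stack of the flat cube's defects (`idef_stack`), components by projection, and the entry-0 defect is TWO-SIDED localized from the cut-offs of BOTH grids' flat cubes.

* §1 `hasMaj_sandwichVE` (`Ŝ′∘𝔇(V̂′,V̂)∘X̂ ≤ βoc_r·A·c_r·e^{−ρ₂d}`), `hasMaj_V_bgPropVE` (`V̂∘X̂ ≤ Rβ(1 − q)⁻¹c_r·e^{−ρ₂d}`);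
* §2 ★★ `hasMaj_idef_bgPropVE` (RECTANGULAR, DECAYING: `𝔇(X̂′, X̂) ≤ (m_Gc_r(1 + Rβ(1−q)⁻¹c_r) + βoc_r·β(1−q)⁻¹·c_r)(1 − q)⁻¹e^{−ρ₂d}`, `q = βRc_r²`);
* §3 ★★ `hasMaj_idef_dressedV_pair` (the jet pair: flat defects `𝔇(G₀′,G₀), 𝔇(D′_j,D_j) ≤ m_Ge^{−δd}` stacked), ★ `hasMaj_idef_dressedV_proj` (every component);
* §4 `idef_out_in` (supports of a defect from the two grids' cut-offs), ★★ `hasMaj_idef_dressedV_loc₂` (entry-0 defect `≤ 1_S(y)1_S(y′)·(…)e^{−ρ₂d}` — FILE 55's `hIG` shape).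

HONEST FRAMING ∕ LIMITS.  Finite-dimensional Neumann∕defect bookkeeping over DISPLAYED letters (flat cube entries and defects at both grids, the perturbation's decay and fit letters — for
`P₁(A)` these are (3.77) and its two-grid fit, NOT proved here); nothing of [B9] asserted ((3.63)–(3.65), (3.76)–(3.77), Thm 3.14 pp. 426–427 = SHAPES ∕ MECHANISM ∕ TEMPLATE).  NE2⁺ NOT
PRINTED, NOT proved; N15 NOT discharged; counts of record UNMOVED (typed 28∕28 · discharged 5∕27); one finite 𝕋⁴ at fixed ε — NOT infinite volume, NOT OS on ℝ⁴, NOT a mass gap, NOT Clay; R4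
closes the conditional finite-𝕋⁴ rung `BalabanLadder.UV` only.  Restate-immune (no Theses import).
-/

set_option autoImplicit false

noncomputable section
open scoped BigOperators
open Finset

namespace Summit.QuantumFields.YangMills.BalabanUVNodes.N15.CurvedSpecies

open Literature.MathematicalPhysics.QuantumFieldTheory.Balaban1983to89
open Literature.MathematicalPhysics.QuantumFieldTheory.Balaban1983to89.B11SectG (BlockNorm HasMaj RowSum hasMaj_comp_exp)
open Literature.MathematicalPhysics.QuantumFieldTheory.Balaban1983to89.B6RandomWalk (Triangle254)
open Literature.MathematicalPhysics.QuantumFieldTheory.Balaban1983to89.B9SectDWeightedNeumann (WRow wrow_of_exp)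
open Literature.MathematicalPhysics.QuantumFieldTheory.Balaban1983to89.T4EtaRateDefect (idef idef_apply)
open Literature.MathematicalPhysics.QuantumFieldTheory.Balaban1983to89.T4EtaRateCoeffDefect (pull pull_apply)
open Literature.MathematicalPhysics.QuantumFieldTheory.Balaban1983to89.B6Prop26Gluing (mulOp mulOp_apply ind ind_nonneg ind_of_mem)
open Summit.QuantumFields.YangMills.BalabanUVNodes.N15.MatrixSpecies (liftBlk liftMap)
open Summit.QuantumFields.YangMills.BalabanUVNodes.N15.DerivDefect (exists_const_hasMaj_ofBlocks)
open Summit.QuantumFields.YangMills.BalabanUVNodes.N15.BackgroundModel (kappa_ofBlocks)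
open Summit.QuantumFields.YangMills.BalabanUVNodes.N15.BackgroundLayer (stack projO blkPair liftPair hasMaj_stack hasMaj_projO_comp idef_stack bgPropV bgPropV_fix)
open Summit.QuantumFields.YangMills.BalabanUVNodes.N15.BackgroundStep (idef_background_propagator_majorant_flat)
open Summit.QuantumFields.YangMills.BalabanUVNodes.N15.Gluing (loc_ofBlocks_eq_zero hasMaj_localize)

/-! ## §1 The sandwiched perturbation defect and the coarse `V̂X̂`, decaying letters -/

section Pieces

variable {X₁ X₂ X₁' X₂' : Type} [Fintype X₁] [Fintype X₂] [Fintype X₁'] [Fintype X₂'] [DecidableEq X₁] [DecidableEq X₂] [DecidableEq X₁'] [DecidableEq X₂']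
  {g : B6.Geometry} (blk₁ : X₁ → g.Site)
  (blk₂ : X₂ → g.Site) (π₁ : X₁' → X₁) (π₂ : X₂' → X₂) {σ cr : ℝ}

omit [DecidableEq X₁] [DecidableEq X₂] [DecidableEq X₁'] [DecidableEq X₂'] in
/-- `Ĝ′∘𝔇(V̂′, V̂)∘X̂ ≤ βoc_r·A·c_r·e^{−ρ₂d}` from `Ĝ′ ≤ βe^{−δd}`, `𝔇(V̂′, V̂) ≤ oe^{−δ_Vd}`, `X̂ ≤ Ae^{−ρ₂d}` (`σ ≤ ρ₁ ≤ δ_V`, `ρ₁ + σ ≤ δ`, `ρ₂ + σ ≤ ρ₁`).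
[cite: Balaban1985BackgroundPropagators, (3.65) p.403 (mechanism), Thm 3.14 pp.426–427 (template)] -/
theorem hasMaj_sandwichVE (htri : Triangle254 g) (hd : ∀ a b : g.Site, 0 ≤ g.dist a b) (hrow : RowSum g σ cr) (hσ : 0 ≤ σ) {ρ₁ ρ₂ δ δV β A o : ℝ} (hβ : 0 ≤ β) (hA : 0 ≤ A)
    (ho : 0 ≤ o) (hcr : 0 ≤ cr) (hσρ : σ ≤ ρ₁) (hρ₁V : ρ₁ ≤ δV) (hρ₁G : ρ₁ + σ ≤ δ) (hρ₂ : 0 ≤ ρ₂) (hρ₂₁ : ρ₂ + σ ≤ ρ₁) {G' : (X₁' → ℝ) →ₗ[ℝ] (X₂' → ℝ)}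
    {V' : (X₂' → ℝ) →ₗ[ℝ] (X₁' → ℝ)} {V : (X₂ → ℝ) →ₗ[ℝ] (X₁ → ℝ)} {Xc : (X₁ → ℝ) →ₗ[ℝ] (X₂ → ℝ)}
    (hG' : HasMaj (BlockNorm.ofBlocks g (blk₁ ∘ π₁)) (BlockNorm.ofBlocks g (blk₂ ∘ π₂)) G' (fun y y' => β * Real.exp (-(δ * g.dist y y'))))
    (hXc : HasMaj (BlockNorm.ofBlocks g blk₁) (BlockNorm.ofBlocks g blk₂) Xc (fun y y' => A * Real.exp (-(ρ₂ * g.dist y y'))))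
    (hDV : HasMaj (BlockNorm.ofBlocks g blk₂) (BlockNorm.ofBlocks g (blk₁ ∘ π₁)) (idef (pull π₂) (pull π₁) V' V) (fun y y' => o * Real.exp (-(δV * g.dist y y')))) :
    HasMaj (BlockNorm.ofBlocks g blk₁) (BlockNorm.ofBlocks g (blk₂ ∘ π₂)) (G' ∘ₗ idef (pull π₂) (pull π₁) V' V ∘ₗ Xc)
      (fun y y' => β * o * cr * A * cr * Real.exp (-(ρ₂ * g.dist y y'))) := by
  have hρ₁ : 0 ≤ ρ₁ := hσ.trans hσρ
  have h1 : HasMaj (BlockNorm.ofBlocks g blk₂) (BlockNorm.ofBlocks g (blk₂ ∘ π₂)) (G' ∘ₗ idef (pull π₂) (pull π₁) V' V)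
      (fun y y' => β * o * cr * Real.exp (-(ρ₁ * g.dist y y'))) := by
    refine (hasMaj_comp_exp htri hd hrow hβ ho hρ₁ hρ₁V hρ₁G hG' hDV).mono fun a b => le_of_eq ?_
    rw [kappa_ofBlocks]; ring
  refine (hasMaj_comp_exp htri hd hrow (by positivity : 0 ≤ β * o * cr) hA hρ₂ le_rfl hρ₂₁ h1 hXc).mono fun a b => le_of_eq ?_
  rw [kappa_ofBlocks]; ring

/-- THE COARSE `V̂∘X̂ ≤ Rβ(1 − q)⁻¹c_r·e^{−ρ₂d}`, `q = βRc_r²`, for a decaying perturbation. [cite: Balaban1985BackgroundPropagators, (3.63) p.402 (shape)] -/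
theorem hasMaj_V_bgPropVE (htri : Triangle254 g) (hd : ∀ a b : g.Site, 0 ≤ g.dist a b) (hrow : RowSum g σ cr) (hσ : 0 ≤ σ) {ρ₁ ρ₂ δ δV β R : ℝ} (hβ : 0 ≤ β) (hR : 0 ≤ R)
    (hcr : 0 ≤ cr) (hσρ : σ ≤ ρ₁) (hρ₁V : ρ₁ ≤ δV) (hρ₁G : ρ₁ + σ ≤ δ) (hρ₂ : 0 ≤ ρ₂) (hρ₂₁ : ρ₂ + σ ≤ ρ₁) {G : (X₁ → ℝ) →ₗ[ℝ] (X₂ → ℝ)} {V : (X₂ → ℝ) →ₗ[ℝ] (X₁ → ℝ)}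
    (hG : HasMaj (BlockNorm.ofBlocks g blk₁) (BlockNorm.ofBlocks g blk₂) G (fun y y' => β * Real.exp (-(δ * g.dist y y'))))
    (hV : HasMaj (BlockNorm.ofBlocks g blk₂) (BlockNorm.ofBlocks g blk₁) V (fun y y' => R * Real.exp (-(δV * g.dist y y')))) (hq : β * (R * cr) * cr < 1) :
    HasMaj (BlockNorm.ofBlocks g blk₁) (BlockNorm.ofBlocks g blk₁) (V ∘ₗ bgPropV G V)
      (fun y y' => R * (β * (1 - β * (R * cr) * cr)⁻¹) * cr * Real.exp (-(ρ₂ * g.dist y y'))) := by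
  have hX := hasMaj_bgPropVE blk₁ blk₂ htri hd hrow hσ hβ hR hcr hσρ hρ₁V hρ₁G hρ₂ hρ₂₁ hG hV hq
  have hβX : 0 ≤ β * (1 - β * (R * cr) * cr)⁻¹ := mul_nonneg hβ (inv_nonneg.2 (by linarith))
  have hρ₂V : ρ₂ + σ ≤ δV := by linarith
  refine (hasMaj_comp_exp htri hd hrow hR hβX hρ₂ le_rfl hρ₂V hV hX).mono fun a b => le_of_eq ?_
  rw [kappa_ofBlocks]; ring

/-! ## §2 The η-defect of the rectangular Neumann series with a decaying perturbation -/

/-- ★★ **THE η-DEFECT OF `X̂ = (1 − ĜV̂)⁻¹Ĝ`, DECAYING PERTURBATION**: coarse∕fine `Ĝ, Ĝ′ ≤ βe^{−δd}` with defect `𝔇(Ĝ′, Ĝ) ≤ m_Ge^{−δd}`; `V̂, V̂′ ≤ Re^{−δ_Vd}` with defect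
`𝔇(V̂′, V̂) ≤ oe^{−δ_Vd}`; rates `σ ≤ ρ₁ ≤ δ_V`, `ρ₁ + σ ≤ δ`, `ρ₂ + σ ≤ ρ₁`; `q = βRc_r² < 1`.  THEN, with `β′ = β(1 − q)⁻¹`,
`𝔇(X̂′, X̂) ≤ (m_Gc_r + m_Gc_r·(Rβ′c_r) + βoc_r·β′·c_r)(1 − q)⁻¹·e^{−ρ₂d}` — dag-n15-c A2's background step fed with decaying letters.
[cite: Balaban1985BackgroundPropagators, (3.63)–(3.65) pp.402–403 (mechanism), (3.76)–(3.77) pp.405–406 (the nonlocal letter), Thm 3.14 pp.426–427 (template)] -/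
theorem hasMaj_idef_bgPropVE (htri : Triangle254 g) (hd : ∀ a b : g.Site, 0 ≤ g.dist a b) (hrow : RowSum g σ cr) (hσ : 0 ≤ σ) (hcr : 0 ≤ cr) {ρ₁ ρ₂ δ δV β R o mG : ℝ}
    (hβ : 0 ≤ β) (hR : 0 ≤ R) (ho : 0 ≤ o) (hmG : 0 ≤ mG) (hσρ : σ ≤ ρ₁) (hρ₁V : ρ₁ ≤ δV) (hρ₁G : ρ₁ + σ ≤ δ) (hρ₂ : 0 ≤ ρ₂) (hρ₂₁ : ρ₂ + σ ≤ ρ₁)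
    {G : (X₁ → ℝ) →ₗ[ℝ] (X₂ → ℝ)} {V : (X₂ → ℝ) →ₗ[ℝ] (X₁ → ℝ)} {G' : (X₁' → ℝ) →ₗ[ℝ] (X₂' → ℝ)} {V' : (X₂' → ℝ) →ₗ[ℝ] (X₁' → ℝ)}
    (hG : HasMaj (BlockNorm.ofBlocks g blk₁) (BlockNorm.ofBlocks g blk₂) G (fun y y' => β * Real.exp (-(δ * g.dist y y'))))
    (hG' : HasMaj (BlockNorm.ofBlocks g (blk₁ ∘ π₁)) (BlockNorm.ofBlocks g (blk₂ ∘ π₂)) G' (fun y y' => β * Real.exp (-(δ * g.dist y y'))))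
    (hDG : HasMaj (BlockNorm.ofBlocks g blk₁) (BlockNorm.ofBlocks g (blk₂ ∘ π₂)) (idef (pull π₁) (pull π₂) G' G) (fun y y' => mG * Real.exp (-(δ * g.dist y y'))))
    (hV : HasMaj (BlockNorm.ofBlocks g blk₂) (BlockNorm.ofBlocks g blk₁) V (fun y y' => R * Real.exp (-(δV * g.dist y y'))))
    (hV' : HasMaj (BlockNorm.ofBlocks g (blk₂ ∘ π₂)) (BlockNorm.ofBlocks g (blk₁ ∘ π₁)) V' (fun y y' => R * Real.exp (-(δV * g.dist y y'))))
    (hDV : HasMaj (BlockNorm.ofBlocks g blk₂) (BlockNorm.ofBlocks g (blk₁ ∘ π₁)) (idef (pull π₂) (pull π₁) V' V) (fun y y' => o * Real.exp (-(δV * g.dist y y'))))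
    (hq : β * (R * cr) * cr < 1) :
    HasMaj (BlockNorm.ofBlocks g blk₁) (BlockNorm.ofBlocks g (blk₂ ∘ π₂)) (idef (pull π₁) (pull π₂) (bgPropV G' V') (bgPropV G V))
      (fun y y' => (mG * cr + 1 * (mG * cr) * (R * (β * (1 - β * (R * cr) * cr)⁻¹) * cr) + β * o * cr * (β * (1 - β * (R * cr) * cr)⁻¹) * cr) *
        (1 - 1 * (β * (R * cr) * cr))⁻¹ * Real.exp (-(ρ₂ * g.dist y y'))) := by
  have hρ₁ : 0 ≤ ρ₁ := hσ.trans hσρ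
  have hq' : 0 < 1 - β * (R * cr) * cr := by linarith
  have hAX : 0 ≤ β * (1 - β * (R * cr) * cr)⁻¹ := mul_nonneg hβ (inv_nonneg.2 hq'.le)
  -- the two fixed-point equations
  have hfix := bgPropV_fix (isUnit_stepVE blk₁ blk₂ htri hd hrow hσ hβ hR hcr hσρ hρ₁V hρ₁G hG hV hq)
  have hfix' := bgPropV_fix (isUnit_stepVE (blk₁ ∘ π₁) (blk₂ ∘ π₂) htri hd hrow hσ hβ hR hcr hσρ hρ₁V hρ₁G hG' hV' hq)
  -- the fine step and its weighted row norm at `ρ₂`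
  have hK' : HasMaj (BlockNorm.ofBlocks g (blk₂ ∘ π₂)) (BlockNorm.ofBlocks g (blk₂ ∘ π₂)) (G' ∘ₗ V') (fun y y' => β * (R * cr) * Real.exp (-(ρ₁ * g.dist y y'))) :=
    (hasMaj_stepVE (blk₁ ∘ π₁) (blk₂ ∘ π₂) htri hd hrow hβ hR hρ₁ hρ₁V hρ₁G hG' hV').mono fun a b => le_of_eq (by ring)
  have hwrow' : WRow g ρ₂ (fun y y' => β * (R * cr) * Real.exp (-(ρ₁ * g.dist y y'))) (β * (R * cr) * cr) :=
    wrow_of_exp hd hrow (mul_nonneg hβ (mul_nonneg hR hcr)) hρ₂₁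
  -- the flat defect's weighted row norm at `ρ₂`
  have hwrowG : WRow g ρ₂ (fun y y' => mG * Real.exp (-(δ * g.dist y y'))) (mG * cr) := wrow_of_exp hd hrow hmG (by linarith)
  -- the coarse `V̂X̂` and the sandwiched perturbation defect
  have hVX := hasMaj_V_bgPropVE blk₁ blk₂ htri hd hrow hσ hβ hR hcr hσρ hρ₁V hρ₁G hρ₂ hρ₂₁ hG hV hq
  have hX := hasMaj_bgPropVE blk₁ blk₂ htri hd hrow hσ hβ hR hcr hσρ hρ₁V hρ₁G hρ₂ hρ₂₁ hG hV hq
  have hDVs := hasMaj_sandwichVE blk₁ blk₂ π₁ π₂ htri hd hrow hσ hβ hAX ho hcr hσρ hρ₁V hρ₁G hρ₂ hρ₂₁ hG' hX hDV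
  -- a priori
  obtain ⟨M₀, hM₀, hap⟩ := exists_const_hasMaj_ofBlocks (g := g) blk₁ (blk₂ ∘ π₂) (idef (pull π₁) (pull π₂) (bgPropV G' V') (bgPropV G V))
  have hq2 : (BlockNorm.ofBlocks g (blk₂ ∘ π₂)).κ * (β * (R * cr) * cr) < 1 := by rw [kappa_ofBlocks, one_mul]; exact hq
  have hAV : 0 ≤ R * (β * (1 - β * (R * cr) * cr)⁻¹) * cr := mul_nonneg (mul_nonneg hR hAX) hcr
  have hcV : 0 ≤ β * o * cr * (β * (1 - β * (R * cr) * cr)⁻¹) * cr := mul_nonneg (mul_nonneg (mul_nonneg (mul_nonneg hβ ho) hcr) hAX) hcr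
  have key := idef_background_propagator_majorant_flat (b₁ := BlockNorm.ofBlocks g blk₁) (b₂' := BlockNorm.ofBlocks g (blk₂ ∘ π₂))
    (τ₁ := pull π₁) (τ₂ := pull π₂) (G₁ := G) (Xc := bgPropV G V) (V := V) (G₁' := G') (Xf := bgPropV G' V') (V' := V') (ρ := ρ₂) htri hd hρ₂
    hAV hcV hM₀ (fun _ _ => mul_nonneg (mul_nonneg hβ (mul_nonneg hR hcr)) (Real.exp_nonneg _)) hwrow' (fun _ _ => mul_nonneg hmG (Real.exp_nonneg _)) hwrowG
    hfix hfix' hK' hVX hDG hDVs hap hq2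
  refine key.mono fun a b => le_of_eq ?_
  rfl

end Pieces

/-! ## §3 The jet pair: stacked flat defects, components -/

section Pair

variable {X X' ι J : Type} [Fintype X] [Fintype X'] [DecidableEq X] [DecidableEq X'] [Fintype ι] [DecidableEq ι] [Fintype J] [DecidableEq J] {g : B6.Geometry}
  (blk : X → g.Site) (π : X' → X) {σ cr : ℝ} {G₀ : (X × ι → ℝ) →ₗ[ℝ] (X × ι → ℝ)} {D : J ⊕ J → (X × ι → ℝ) →ₗ[ℝ] (X × ι → ℝ)}
  {V : ((X × ι) × Option (J ⊕ J) → ℝ) →ₗ[ℝ] (X × ι → ℝ)} {G₀' : (X' × ι → ℝ) →ₗ[ℝ] (X' × ι → ℝ)} {D' : J ⊕ J → (X' × ι → ℝ) →ₗ[ℝ] (X' × ι → ℝ)}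
  {V' : ((X' × ι) × Option (J ⊕ J) → ℝ) →ₗ[ℝ] (X' × ι → ℝ)}

/-- ★★ **THE η-DEFECT OF THE DRESSED CUBE PAIR, DECAYING PERTURBATION OF THE JET**: flat cube entries `G₀, D_j, G₀′, D′_j ≤ βe^{−δd}`, flat defects `𝔇(G₀′, G₀), 𝔇(D′_j, D_j) ≤ m_Ge^{−δd}`,
perturbations `V̂, V̂′ ≤ Re^{−δ_Vd}` with fit `𝔇(V̂′, V̂) ≤ oe^{−δ_Vd}` ⟹ `𝔇(X̂′, X̂) ≤ (…)(1 − q)⁻¹e^{−ρ₂d}` as in `hasMaj_idef_bgPropVE`, through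
`(pull (liftMap π ι), pull (liftPair (liftMap π ι)))`. [cite: Balaban1985BackgroundPropagators, (3.63)–(3.65) pp.402–403, Thm 3.14 pp.426–427 (template)] -/
theorem hasMaj_idef_dressedV_pair (htri : Triangle254 g) (hd : ∀ a b : g.Site, 0 ≤ g.dist a b) (hrow : RowSum g σ cr) (hσ : 0 ≤ σ) (hcr : 0 ≤ cr) {ρ₁ ρ₂ δ δV β R o mG : ℝ}
    (hβ : 0 ≤ β) (hR : 0 ≤ R) (ho : 0 ≤ o) (hmG : 0 ≤ mG) (hσρ : σ ≤ ρ₁) (hρ₁V : ρ₁ ≤ δV) (hρ₁G : ρ₁ + σ ≤ δ) (hρ₂ : 0 ≤ ρ₂) (hρ₂₁ : ρ₂ + σ ≤ ρ₁)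
    (hG : HasMaj (BlockNorm.ofBlocks g (liftBlk blk ι)) (BlockNorm.ofBlocks g (liftBlk blk ι)) G₀ (fun y y' => β * Real.exp (-(δ * g.dist y y'))))
    (hD : ∀ j, HasMaj (BlockNorm.ofBlocks g (liftBlk blk ι)) (BlockNorm.ofBlocks g (liftBlk blk ι)) (D j) (fun y y' => β * Real.exp (-(δ * g.dist y y'))))
    (hG' : HasMaj (BlockNorm.ofBlocks g (liftBlk (blk ∘ π) ι)) (BlockNorm.ofBlocks g (liftBlk (blk ∘ π) ι)) G₀' (fun y y' => β * Real.exp (-(δ * g.dist y y'))))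
    (hD' : ∀ j, HasMaj (BlockNorm.ofBlocks g (liftBlk (blk ∘ π) ι)) (BlockNorm.ofBlocks g (liftBlk (blk ∘ π) ι)) (D' j) (fun y y' => β * Real.exp (-(δ * g.dist y y'))))
    (hDG : HasMaj (BlockNorm.ofBlocks g (liftBlk blk ι)) (BlockNorm.ofBlocks g (liftBlk (blk ∘ π) ι)) (idef (pull (liftMap π ι)) (pull (liftMap π ι)) G₀' G₀)
      (fun y y' => mG * Real.exp (-(δ * g.dist y y'))))
    (hDD : ∀ j, HasMaj (BlockNorm.ofBlocks g (liftBlk blk ι)) (BlockNorm.ofBlocks g (liftBlk (blk ∘ π) ι)) (idef (pull (liftMap π ι)) (pull (liftMap π ι)) (D' j) (D j))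
      (fun y y' => mG * Real.exp (-(δ * g.dist y y'))))
    (hV : HasMaj (BlockNorm.ofBlocks g (blkPair (liftBlk blk ι))) (BlockNorm.ofBlocks g (liftBlk blk ι)) V (fun y y' => R * Real.exp (-(δV * g.dist y y'))))
    (hV' : HasMaj (BlockNorm.ofBlocks g (blkPair (liftBlk (blk ∘ π) ι))) (BlockNorm.ofBlocks g (liftBlk (blk ∘ π) ι)) V' (fun y y' => R * Real.exp (-(δV * g.dist y y'))))
    (hDV : HasMaj (BlockNorm.ofBlocks g (blkPair (liftBlk blk ι))) (BlockNorm.ofBlocks g (liftBlk (blk ∘ π) ι))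
      (idef (pull (liftPair (liftMap π ι))) (pull (liftMap π ι)) V' V) (fun y y' => o * Real.exp (-(δV * g.dist y y'))))
    (hq : β * (R * cr) * cr < 1) :
    HasMaj (BlockNorm.ofBlocks g (liftBlk blk ι)) (BlockNorm.ofBlocks g (blkPair (liftBlk (blk ∘ π) ι)))
      (idef (pull (liftMap π ι)) (pull (liftPair (liftMap π ι))) (bgPropV (stack G₀' D') V') (bgPropV (stack G₀ D) V))
      (fun y y' => (mG * cr + 1 * (mG * cr) * (R * (β * (1 - β * (R * cr) * cr)⁻¹) * cr) + β * o * cr * (β * (1 - β * (R * cr) * cr)⁻¹) * cr) *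
        (1 - 1 * (β * (R * cr) * cr))⁻¹ * Real.exp (-(ρ₂ * g.dist y y'))) := by
  have hβe : ∀ y y' : g.Site, 0 ≤ β * Real.exp (-(δ * g.dist y y')) := fun _ _ => mul_nonneg hβ (Real.exp_nonneg _)
  have hme : ∀ y y' : g.Site, 0 ≤ mG * Real.exp (-(δ * g.dist y y')) := fun _ _ => mul_nonneg hmG (Real.exp_nonneg _)
  have hSG := hasMaj_stack (liftBlk blk ι) hβe hG hD
  have hSG' := hasMaj_stack (liftBlk (blk ∘ π) ι) hβe hG' hD'
  have hSD : HasMaj (BlockNorm.ofBlocks g (liftBlk blk ι)) (BlockNorm.ofBlocks g (blkPair (liftBlk (blk ∘ π) ι)))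
      (idef (pull (liftMap π ι)) (pull (liftPair (liftMap π ι))) (stack G₀' D') (stack G₀ D)) (fun y y' => mG * Real.exp (-(δ * g.dist y y'))) := by
    rw [idef_stack]
    exact hasMaj_stack (liftBlk (blk ∘ π) ι) hme hDG hDD
  exact hasMaj_idef_bgPropVE (liftBlk blk ι) (blkPair (liftBlk blk ι)) (liftMap π ι) (liftPair (liftMap π ι)) htri hd hrow hσ hcr hβ hR ho hmG hσρ hρ₁V hρ₁G hρ₂ hρ₂₁
    hSG hSG' hSD hV hV' hDV hq

/-- ★ … componentwise: `𝔇(pr_jX̂′, pr_jX̂)` inherits the pair's defect letter (`j = none`: entry 0; `j = ±μ`: entries 1). [cite: Balaban1985BackgroundPropagators, Thm 3.14 (template)] -/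
theorem hasMaj_idef_dressedV_proj (htri : Triangle254 g) (hd : ∀ a b : g.Site, 0 ≤ g.dist a b) (hrow : RowSum g σ cr) (hσ : 0 ≤ σ) (hcr : 0 ≤ cr) {ρ₁ ρ₂ δ δV β R o mG : ℝ}
    (hβ : 0 ≤ β) (hR : 0 ≤ R) (ho : 0 ≤ o) (hmG : 0 ≤ mG) (hσρ : σ ≤ ρ₁) (hρ₁V : ρ₁ ≤ δV) (hρ₁G : ρ₁ + σ ≤ δ) (hρ₂ : 0 ≤ ρ₂) (hρ₂₁ : ρ₂ + σ ≤ ρ₁)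
    (hG : HasMaj (BlockNorm.ofBlocks g (liftBlk blk ι)) (BlockNorm.ofBlocks g (liftBlk blk ι)) G₀ (fun y y' => β * Real.exp (-(δ * g.dist y y'))))
    (hD : ∀ j, HasMaj (BlockNorm.ofBlocks g (liftBlk blk ι)) (BlockNorm.ofBlocks g (liftBlk blk ι)) (D j) (fun y y' => β * Real.exp (-(δ * g.dist y y'))))
    (hG' : HasMaj (BlockNorm.ofBlocks g (liftBlk (blk ∘ π) ι)) (BlockNorm.ofBlocks g (liftBlk (blk ∘ π) ι)) G₀' (fun y y' => β * Real.exp (-(δ * g.dist y y'))))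
    (hD' : ∀ j, HasMaj (BlockNorm.ofBlocks g (liftBlk (blk ∘ π) ι)) (BlockNorm.ofBlocks g (liftBlk (blk ∘ π) ι)) (D' j) (fun y y' => β * Real.exp (-(δ * g.dist y y'))))
    (hDG : HasMaj (BlockNorm.ofBlocks g (liftBlk blk ι)) (BlockNorm.ofBlocks g (liftBlk (blk ∘ π) ι)) (idef (pull (liftMap π ι)) (pull (liftMap π ι)) G₀' G₀)
      (fun y y' => mG * Real.exp (-(δ * g.dist y y'))))
    (hDD : ∀ j, HasMaj (BlockNorm.ofBlocks g (liftBlk blk ι)) (BlockNorm.ofBlocks g (liftBlk (blk ∘ π) ι)) (idef (pull (liftMap π ι)) (pull (liftMap π ι)) (D' j) (D j))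
      (fun y y' => mG * Real.exp (-(δ * g.dist y y'))))
    (hV : HasMaj (BlockNorm.ofBlocks g (blkPair (liftBlk blk ι))) (BlockNorm.ofBlocks g (liftBlk blk ι)) V (fun y y' => R * Real.exp (-(δV * g.dist y y'))))
    (hV' : HasMaj (BlockNorm.ofBlocks g (blkPair (liftBlk (blk ∘ π) ι))) (BlockNorm.ofBlocks g (liftBlk (blk ∘ π) ι)) V' (fun y y' => R * Real.exp (-(δV * g.dist y y'))))
    (hDV : HasMaj (BlockNorm.ofBlocks g (blkPair (liftBlk blk ι))) (BlockNorm.ofBlocks g (liftBlk (blk ∘ π) ι))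
      (idef (pull (liftPair (liftMap π ι))) (pull (liftMap π ι)) V' V) (fun y y' => o * Real.exp (-(δV * g.dist y y'))))
    (hq : β * (R * cr) * cr < 1) (j : Option (J ⊕ J)) :
    HasMaj (BlockNorm.ofBlocks g (liftBlk blk ι)) (BlockNorm.ofBlocks g (liftBlk (blk ∘ π) ι))
      (idef (pull (liftMap π ι)) (pull (liftMap π ι)) (projO j ∘ₗ bgPropV (stack G₀' D') V') (projO j ∘ₗ bgPropV (stack G₀ D) V))
      (fun y y' => (mG * cr + 1 * (mG * cr) * (R * (β * (1 - β * (R * cr) * cr)⁻¹) * cr) + β * o * cr * (β * (1 - β * (R * cr) * cr)⁻¹) * cr) *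
        (1 - 1 * (β * (R * cr) * cr))⁻¹ * Real.exp (-(ρ₂ * g.dist y y'))) := by
  have key := hasMaj_idef_dressedV_pair blk π htri hd hrow hσ hcr hβ hR ho hmG hσρ hρ₁V hρ₁G hρ₂ hρ₂₁ hG hD hG' hD' hDG hDD hV hV' hDV hq
  have hcomp : idef (pull (liftMap π ι)) (pull (liftMap π ι)) (projO j ∘ₗ bgPropV (stack G₀' D') V') (projO j ∘ₗ bgPropV (stack G₀ D) V) =
      projO j ∘ₗ idef (pull (liftMap π ι)) (pull (liftPair (liftMap π ι))) (bgPropV (stack G₀' D') V') (bgPropV (stack G₀ D) V) :=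
    LinearMap.ext fun v => funext fun x' => rfl
  rw [hcomp]
  exact hasMaj_projO_comp (liftBlk (blk ∘ π) ι) key j

/-! ## §4 Two-sided localization of the entry-0 defect -/

omit [Fintype X] [Fintype X'] [DecidableEq X] [DecidableEq X'] [Fintype ι] [DecidableEq ι] [Fintype J] [DecidableEq J] in
/-- SUPPORTS OF A DEFECT FROM THE TWO GRIDS' CUT-OFFS: if the coarse `T = M_χT` (outputs over `S`, blocks `blk`) and `T = TM_ψ` (inputs over `S`), and the fine `T′ = M_{χ′}T′`, `T′ = T′M_{ψ′}`
(over `S`, blocks `blk∘π`), then `𝔇(T′, T) = pull∘T − T′∘pull` has outputs over `S` (fine blocks) and reads inputs over `S` (coarse blocks) only. [folklore] -/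
theorem idef_out_in {T : (X × ι → ℝ) →ₗ[ℝ] (X × ι → ℝ)} {T' : (X' × ι → ℝ) →ₗ[ℝ] (X' × ι → ℝ)} {S : Set g.Site} {χX ψX : X → ℝ} {χX' ψX' : X' → ℝ}
    (hSχ : ∀ x, χX x ≠ 0 → blk x ∈ S) (hSψ : ∀ x, ψX x ≠ 0 → blk x ∈ S) (hSχ' : ∀ x', χX' x' ≠ 0 → blk (π x') ∈ S) (hSψ' : ∀ x', ψX' x' ≠ 0 → blk (π x') ∈ S)
    (hTχ : mulOp (fun p : X × ι => χX p.1) ∘ₗ T = T) (hTψ : T ∘ₗ mulOp (fun p : X × ι => ψX p.1) = T)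
    (hTχ' : mulOp (fun p : X' × ι => χX' p.1) ∘ₗ T' = T') (hTψ' : T' ∘ₗ mulOp (fun p : X' × ι => ψX' p.1) = T') :
    (∀ μ p', liftBlk (blk ∘ π) ι p' ∉ S → idef (pull (liftMap π ι)) (pull (liftMap π ι)) T' T μ p' = 0) ∧
      (∀ μ : X × ι → ℝ, (∀ p, liftBlk blk ι p ∈ S → μ p = 0) → idef (pull (liftMap π ι)) (pull (liftMap π ι)) T' T μ = 0) := by
  refine ⟨fun μ p' hp' => ?_, fun μ hμ => ?_⟩
  · have hχ0 : χX (π p'.1) = 0 := by by_contra h; exact hp' (hSχ (π p'.1) h)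
    have hχ0' : χX' p'.1 = 0 := by by_contra h; exact hp' (hSχ' p'.1 h)
    rw [idef_apply, Pi.sub_apply, pull_apply, ← hTχ, LinearMap.comp_apply, ← hTχ', LinearMap.comp_apply]
    simp only [mulOp_apply, liftMap, hχ0, hχ0', zero_mul, sub_zero]
  · have h0 : T μ = 0 := by rw [← hTψ, LinearMap.comp_apply, mulOp_eq_zero_of_vanish blk hSψ μ hμ, map_zero]
    have h0' : T' (pull (liftMap π ι) μ) = 0 := by
      rw [← hTψ', LinearMap.comp_apply, mulOp_eq_zero_of_vanish (blk ∘ π) hSψ' _ (fun p' hp' => ?_), map_zero]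
      rw [pull_apply]
      exact hμ _ hp'
    refine funext fun p' => ?_
    rw [idef_apply, Pi.sub_apply, pull_apply, h0, h0']
    simp

/-- ★★ **THE ENTRY-0 DEFECT OF THE DRESSED CUBE, TWO-SIDED LOCALIZED** (FILE 55's `hIG` shape): with both grids' flat cubes cut off over `S` on both sides (`G₀ = M_χG₀ = G₀M_ψ`,
`G₀′ = M_{χ′}G₀′ = G₀′M_{ψ′}`) and `D = Dq∘G₀`, `D′ = Dq′∘G₀′`: `𝔇(pr₀X̂′, pr₀X̂) ≤ 1_S(y)1_S(y′)·(…)(1 − q)⁻¹e^{−ρ₂d}`.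
[cite: Balaban1984PropagatorsII, (2.133) p.247 (shape); Balaban1985BackgroundPropagators, (3.65) p.403, Thm 3.14 pp.426–427 (template)] -/
theorem hasMaj_idef_dressedV_loc₂ (htri : Triangle254 g) (hd : ∀ a b : g.Site, 0 ≤ g.dist a b) (hrow : RowSum g σ cr) (hσ : 0 ≤ σ) (hcr : 0 ≤ cr) {ρ₁ ρ₂ δ δV β R o mG : ℝ}
    (hβ : 0 ≤ β) (hR : 0 ≤ R) (ho : 0 ≤ o) (hmG : 0 ≤ mG) (hσρ : σ ≤ ρ₁) (hρ₁V : ρ₁ ≤ δV) (hρ₁G : ρ₁ + σ ≤ δ) (hρ₂ : 0 ≤ ρ₂) (hρ₂₁ : ρ₂ + σ ≤ ρ₁)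
    {Dq : J ⊕ J → (X × ι → ℝ) →ₗ[ℝ] (X × ι → ℝ)} {Dq' : J ⊕ J → (X' × ι → ℝ) →ₗ[ℝ] (X' × ι → ℝ)} (hDq : ∀ j, D j = Dq j ∘ₗ G₀) (hDq' : ∀ j, D' j = Dq' j ∘ₗ G₀')
    {S : Set g.Site} {χX ψX : X → ℝ} {χX' ψX' : X' → ℝ} (hSχ : ∀ x, χX x ≠ 0 → blk x ∈ S) (hSψ : ∀ x, ψX x ≠ 0 → blk x ∈ S)
    (hSχ' : ∀ x', χX' x' ≠ 0 → blk (π x') ∈ S) (hSψ' : ∀ x', ψX' x' ≠ 0 → blk (π x') ∈ S) (hGχ : mulOp (fun p : X × ι => χX p.1) ∘ₗ G₀ = G₀)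
    (hGψ : G₀ ∘ₗ mulOp (fun p : X × ι => ψX p.1) = G₀) (hGχ' : mulOp (fun p : X' × ι => χX' p.1) ∘ₗ G₀' = G₀') (hGψ' : G₀' ∘ₗ mulOp (fun p : X' × ι => ψX' p.1) = G₀')
    (hG : HasMaj (BlockNorm.ofBlocks g (liftBlk blk ι)) (BlockNorm.ofBlocks g (liftBlk blk ι)) G₀ (fun y y' => β * Real.exp (-(δ * g.dist y y'))))
    (hD : ∀ j, HasMaj (BlockNorm.ofBlocks g (liftBlk blk ι)) (BlockNorm.ofBlocks g (liftBlk blk ι)) (D j) (fun y y' => β * Real.exp (-(δ * g.dist y y'))))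
    (hG' : HasMaj (BlockNorm.ofBlocks g (liftBlk (blk ∘ π) ι)) (BlockNorm.ofBlocks g (liftBlk (blk ∘ π) ι)) G₀' (fun y y' => β * Real.exp (-(δ * g.dist y y'))))
    (hD' : ∀ j, HasMaj (BlockNorm.ofBlocks g (liftBlk (blk ∘ π) ι)) (BlockNorm.ofBlocks g (liftBlk (blk ∘ π) ι)) (D' j) (fun y y' => β * Real.exp (-(δ * g.dist y y'))))
    (hDG : HasMaj (BlockNorm.ofBlocks g (liftBlk blk ι)) (BlockNorm.ofBlocks g (liftBlk (blk ∘ π) ι)) (idef (pull (liftMap π ι)) (pull (liftMap π ι)) G₀' G₀)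
      (fun y y' => mG * Real.exp (-(δ * g.dist y y'))))
    (hDD : ∀ j, HasMaj (BlockNorm.ofBlocks g (liftBlk blk ι)) (BlockNorm.ofBlocks g (liftBlk (blk ∘ π) ι)) (idef (pull (liftMap π ι)) (pull (liftMap π ι)) (D' j) (D j))
      (fun y y' => mG * Real.exp (-(δ * g.dist y y'))))
    (hV : HasMaj (BlockNorm.ofBlocks g (blkPair (liftBlk blk ι))) (BlockNorm.ofBlocks g (liftBlk blk ι)) V (fun y y' => R * Real.exp (-(δV * g.dist y y'))))
    (hV' : HasMaj (BlockNorm.ofBlocks g (blkPair (liftBlk (blk ∘ π) ι))) (BlockNorm.ofBlocks g (liftBlk (blk ∘ π) ι)) V' (fun y y' => R * Real.exp (-(δV * g.dist y y'))))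
    (hDV : HasMaj (BlockNorm.ofBlocks g (blkPair (liftBlk blk ι))) (BlockNorm.ofBlocks g (liftBlk (blk ∘ π) ι))
      (idef (pull (liftPair (liftMap π ι))) (pull (liftMap π ι)) V' V) (fun y y' => o * Real.exp (-(δV * g.dist y y'))))
    (hq : β * (R * cr) * cr < 1) :
    HasMaj (BlockNorm.ofBlocks g (liftBlk blk ι)) (BlockNorm.ofBlocks g (liftBlk (blk ∘ π) ι))
      (idef (pull (liftMap π ι)) (pull (liftMap π ι)) (projO none ∘ₗ bgPropV (stack G₀' D') V') (projO none ∘ₗ bgPropV (stack G₀ D) V))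
      (fun y y' => ind S y * ind S y' * ((mG * cr + 1 * (mG * cr) * (R * (β * (1 - β * (R * cr) * cr)⁻¹) * cr) + β * o * cr * (β * (1 - β * (R * cr) * cr)⁻¹) * cr) *
        (1 - 1 * (β * (R * cr) * cr))⁻¹ * Real.exp (-(ρ₂ * g.dist y y')))) := by
  have key := hasMaj_idef_dressedV_proj blk π htri hd hrow hσ hcr hβ hR ho hmG hσρ hρ₁V hρ₁G hρ₂ hρ₂₁ hG hD hG' hD' hDG hDD hV hV' hDV hq none
  have hq' : 0 < 1 - β * (R * cr) * cr := by linarith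
  have hK0 : ∀ a b : g.Site, 0 ≤ (mG * cr + 1 * (mG * cr) * (R * (β * (1 - β * (R * cr) * cr)⁻¹) * cr) + β * o * cr * (β * (1 - β * (R * cr) * cr)⁻¹) * cr) *
      (1 - 1 * (β * (R * cr) * cr))⁻¹ * Real.exp (-(ρ₂ * g.dist a b)) := fun a b => by
    have h1 : 0 ≤ (1 - β * (R * cr) * cr)⁻¹ := inv_nonneg.2 hq'.le
    have h2 : 0 ≤ (1 - 1 * (β * (R * cr) * cr))⁻¹ := inv_nonneg.2 (by linarith)
    positivity
  -- the units and the supports of the two dressed entries 0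
  obtain ⟨hunit, -⟩ := hasMaj_dressedV_pair blk htri hd hrow hσ hβ hR hcr hσρ hρ₁V hρ₁G hρ₂ hρ₂₁ hG hD hV hq
  obtain ⟨hunit', -⟩ := hasMaj_dressedV_pair (blk ∘ π) htri hd hrow hσ hβ hR hcr hσρ hρ₁V hρ₁G hρ₂ hρ₂₁ hG' hD' hV' hq
  have hfac := projO_none_dressedV (G₀ := G₀) (D := D) (V := V) hunit
  have hfac' := projO_none_dressedV (G₀ := G₀') (D := D') (V := V') hunit'
  have hXχ : mulOp (fun p : X × ι => χX p.1) ∘ₗ (projO none ∘ₗ bgPropV (stack G₀ D) V) = projO none ∘ₗ bgPropV (stack G₀ D) V := by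
    rw [hfac, ← LinearMap.comp_assoc, hGχ]
  have hXχ' : mulOp (fun p : X' × ι => χX' p.1) ∘ₗ (projO none ∘ₗ bgPropV (stack G₀' D') V') = projO none ∘ₗ bgPropV (stack G₀' D') V' := by
    rw [hfac', ← LinearMap.comp_assoc, hGχ']
  have hXψ : (projO none ∘ₗ bgPropV (stack G₀ D) V) ∘ₗ mulOp (fun p : X × ι => ψX p.1) = projO none ∘ₗ bgPropV (stack G₀ D) V := by
    rw [LinearMap.comp_assoc, dressedV_comp_eq_self (V := V) hDq hGψ]
  have hXψ' : (projO none ∘ₗ bgPropV (stack G₀' D') V') ∘ₗ mulOp (fun p : X' × ι => ψX' p.1) = projO none ∘ₗ bgPropV (stack G₀' D') V' := by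
    rw [LinearMap.comp_assoc, dressedV_comp_eq_self (V := V') hDq' hGψ']
  obtain ⟨hout, hin⟩ := idef_out_in blk π hSχ hSψ hSχ' hSψ' hXχ hXψ hXχ' hXψ'
  exact hasMaj_localize (liftBlk blk ι) (liftBlk (blk ∘ π) ι) hK0 hout hin key

end Pair

end Summit.QuantumFields.YangMills.BalabanUVNodes.N15.CurvedSpecies

end
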